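import Summits.BirchSwinnertonDyer.BirchSwinnertonDyer.Theorems.ByReductionTypeAtTwoTowerLayerTorsionCert
import Summits.BirchSwinnertonDyer.BirchSwinnertonDyer.Theorems.ByReductionTypeAtTwoTowerLayerTorsionLocal
import Literature.NumberTheory.EllipticCurves.X1ElevenMordellWeil
import Literature.NumberTheory.EllipticCurves.VariableChangePointsMap
import HarnessLib

/-!
# TOWER road — TORSION-EXACT layer-`j` certificate `#E[2^∞]^{Gal(ℚ̄/ℚ_j)} ≤ 2` from TWO good primes
# (route ByReductionTypeAtTwo, items 19271 / 19573; seat bsd-2adic-ord-2 GEN 7). THEOREMS ONLY; closes nothing by itself.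

The gap doors display `htor : #E[2^∞]^{Gal(ℚ̄/ℚ_j)} ≤ 2^t`; `…TowerLayerTorsionCert/Local` certify `t = ord₂ #Ẽ(𝔽_ℓ)`
at ONE good `ℓ ≡ 1 (mod 2^{j+2})`, which is `2` for many curves with one rational `2`-torsion point although the
fixed torsion is `ℤ/2` (`4 ∣ #Ẽ(𝔽_ℓ)` for all `ℓ ≡ 1 (mod 4)`). Here `t = 1` from the GROUP STRUCTURE at two good
primes `ℓ₁, ℓ₂ ≡ 1 (mod 2^{j+2})`: at `ℓ₂`, `¬ 8 ∣ #Ẽ(𝔽_{ℓ₂})` and three `𝔽_{ℓ₂}`-roots of the `2`-division cubic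
force `Ẽ(𝔽_{ℓ₂})[2^∞] = Ẽ[2]` (§1–§2), so — `E(ℚ_{ℓ₂})[2^v] ↪ Ẽ(𝔽_{ℓ₂})` as a GROUP (§3, tree `reductionHom`,
AEC VII.3.1) — every `Gal(ℚ̄/ℚ_j)`-fixed point of `E[2^∞]` is killed by `2`; at `ℓ₁`, at most one root gives
`#Ẽ(𝔽_{ℓ₁})[2] ≤ 2 ≥ #E(ℚ_{ℓ₁})[2] ≥ #E[2^∞]^{Gal(ℚ̄/ℚ_j)}` (§4). §5: the gap door with `t = 1`.
References: [SilvermanAEC2009] VII.3 Prop. 3.1, VIII.§1, III.2.3; [GreenbergLNM1716] §1, §3, §4 Lemma 4.3; [Washington1997] §13.1.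
-/

set_option autoImplicit false
set_option linter.dupNamespace false -- route Theorems namespace repeats a component by design (D-0017)

noncomputable section

open scoped Classical
open WeierstrassCurve Literature.NumberTheory.EllipticCurves Literature.NumberTheory.GaloisRepresentations

namespace Summit.BirchSwinnertonDyer.BirchSwinnertonDyer.Theorems.TowerLayer

/-! ## §1 Finite abelian groups: `¬ 8 ∣ #G` and `4 ≤ #G[2]` force `G[2^∞] = G[2]` -/

section Group

variable {G : Type*} [AddCommGroup G] [Finite G]

/-- In a finite abelian group with `¬ 8 ∣ #G` and `4 ≤ #G[2]`, `4 • g = 0 ⇒ 2 • g = 0` (`G[4]` is a `2`-group of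
order `∣ #G`, so `#G[4] ≤ 4 ≤ #G[2]` and `G[4] = G[2]`). [folklore] -/
theorem two_nsmul_eq_zero_of_four_nsmul_eq_zero (h8 : ¬ 8 ∣ Nat.card G)
    (h4 : 4 ≤ Nat.card {g : G // 2 • g = 0}) {g : G} (hg : 4 • g = 0) : 2 • g = 0 := by
  let A : AddSubgroup G := (DistribSMul.toAddMonoidHom G (4 : ℕ)).ker
  have hA : ∀ x, x ∈ A ↔ 4 • x = 0 := fun x ↦ by
    simp only [A, AddMonoidHom.mem_ker, DistribSMul.toAddMonoidHom_apply]
  have hpg : IsPGroup 2 (Multiplicative A) := fun x ↦ ⟨2, by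
    apply Multiplicative.toAdd.injective
    rw [toAdd_pow, toAdd_one]
    exact Subtype.ext (by
      rw [AddSubgroup.coe_nsmul, AddSubgroup.coe_zero]; exact (hA _).mp (Multiplicative.toAdd x).2)⟩
  obtain ⟨j, hj⟩ := IsPGroup.iff_card.mp hpg
  have hjA : Nat.card A = 2 ^ j := by rw [← hj]; exact Nat.card_congr Multiplicative.ofAdd
  have hdvd : 2 ^ j ∣ Nat.card G := by rw [← hjA]; exact AddSubgroup.card_addSubgroup_dvd_card A
  have hj2 : j ≤ 2 := by
    by_contra hj3
    exact h8 ((pow_dvd_pow 2 (by omega : 3 ≤ j)).trans hdvd)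
  have hcardA : Nat.card A ≤ 4 := by
    rw [hjA]
    calc 2 ^ j ≤ 2 ^ 2 := Nat.pow_le_pow_right two_pos hj2
      _ = 4 := by norm_num
  let f : {g : G // 2 • g = 0} → A := fun x ↦ ⟨x.1, (hA _).mpr (by
    rw [show (4 : ℕ) = 2 * 2 from rfl, mul_nsmul, x.2, nsmul_zero])⟩
  have hf : Function.Injective f := fun x y hxy ↦ Subtype.ext (congrArg (fun a : A ↦ (a : G)) hxy)
  haveI : Fintype {g : G // 2 • g = 0} := Fintype.ofFinite _
  haveI : Fintype A := Fintype.ofFinite _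
  have hbij : Function.Bijective f := by
    rw [Fintype.bijective_iff_injective_and_card]
    refine ⟨hf, le_antisymm (Fintype.card_le_of_injective f hf) ?_⟩
    rw [← Nat.card_eq_fintype_card, ← Nat.card_eq_fintype_card]
    exact hcardA.trans h4
  obtain ⟨x, hx⟩ := hbij.2 ⟨g, (hA g).mpr hg⟩
  have hxg : (x : G) = g := congrArg (fun a : A ↦ (a : G)) hx
  rw [← hxg]
  exact x.2

/-- `G[2^∞] = G[2]` under the same hypotheses: `2^k • g = 0 ⇒ 2 • g = 0`. [folklore] -/
theorem two_nsmul_eq_zero_of_pow_nsmul_eq_zero (h8 : ¬ 8 ∣ Nat.card G)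
    (h4 : 4 ≤ Nat.card {g : G // 2 • g = 0}) {g : G} {k : ℕ} (hg : 2 ^ k • g = 0) : 2 • g = 0 := by
  induction k generalizing g with
  | zero => rw [pow_zero, one_nsmul] at hg; rw [hg, nsmul_zero]
  | succ k ih =>
    rcases k with _ | k
    · simpa using hg
    · -- `4 • (2^k • g) = 2^(k+2) • g = 0`, so `2 • (2^k • g) = 0`, i.e. `2^(k+1) • g = 0`
      have h4g : 4 • (2 ^ k • g) = 0 := by
        rw [smul_smul, show 4 * 2 ^ k = 2 ^ (k + 1 + 1) by ring]; exact hg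
      have h2g : 2 ^ (k + 1) • g = 0 := by
        rw [pow_succ', ← smul_smul]
        exact two_nsmul_eq_zero_of_four_nsmul_eq_zero h8 h4 h4g
      exact ih h2g

end Group

/-! ## §2 The `2`-torsion of a Weierstrass curve over a field of characteristic `≠ 2` -/

section TwoTorsion

variable {F : Type*} [Field F] [DecidableEq F] (V : WeierstrassCurve F)

/-- A point `(x, y)` killed by `2` has `2y + a₁x + a₃ = 0` (`P = −P`). [cite: SilvermanAEC2009, III.2.3] -/
theorem two_mul_y_eq_of_two_nsmul_eq_zero {x y : F} {h : V.toAffine.Nonsingular x y}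
    (h2 : (2 : ℕ) • (Affine.Point.some x y h : V.toAffine.Point) = 0) : 2 * y + V.a₁ * x + V.a₃ = 0 := by
  have hneg : -(Affine.Point.some x y h : V.toAffine.Point) = Affine.Point.some x y h := by
    rw [two_nsmul] at h2
    exact (neg_eq_of_add_eq_zero_left h2)
  rw [Affine.Point.neg_some, Affine.Point.some.injEq] at hneg
  have hy : V.toAffine.negY x y = y := hneg.2
  rw [Affine.negY] at hy
  linear_combination -hy

/-- Conversely `2y + a₁x + a₃ = 0` gives `2 • (x, y) = 𝒪`. [cite: SilvermanAEC2009, III.2.3] -/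
theorem two_nsmul_eq_zero_of_two_mul_y_eq {x y : F} (h : V.toAffine.Nonsingular x y)
    (hy : 2 * y + V.a₁ * x + V.a₃ = 0) : (2 : ℕ) • (Affine.Point.some x y h : V.toAffine.Point) = 0 := by
  have hneg : -(Affine.Point.some x y h : V.toAffine.Point) = Affine.Point.some x y h := by
    rw [Affine.Point.neg_some]
    have : V.toAffine.negY x y = y := by rw [Affine.negY]; linear_combination -hy
    simp only [this]
  rw [two_nsmul]
  nth_rw 1 [← hneg]
  exact neg_add_cancel _

variable [Fintype F]

/-- **`#E(F)[2] ≤ 1 + #{x ∈ F : u² + 2a₁xu + 2a₃u = 4(x³ + a₂x² + a₄x + a₆)}`, `u = −(a₁x + a₃)`** (finite `F`,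
`2 ≠ 0`; division-free reading of `(x, u/2) ∈ E`): `P ↦ x(P)` is injective on `E(F)[2]`. [cite: SilvermanAEC2009, III.2.3] -/
theorem natCard_two_torsion_le (h2 : (2 : F) ≠ 0) [Finite V.toAffine.Point] :
    Nat.card {P : V.toAffine.Point // 2 • P = 0} ≤
      (Finset.univ.filter (fun x : F ↦
        (-(V.a₁ * x + V.a₃)) ^ 2 + 2 * V.a₁ * x * (-(V.a₁ * x + V.a₃)) + 2 * V.a₃ * (-(V.a₁ * x + V.a₃)) =
          4 * (x ^ 3 + V.a₂ * x ^ 2 + V.a₄ * x + V.a₆))).card + 1 := by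
  set S := Finset.univ.filter (fun x : F ↦
        (-(V.a₁ * x + V.a₃)) ^ 2 + 2 * V.a₁ * x * (-(V.a₁ * x + V.a₃)) + 2 * V.a₃ * (-(V.a₁ * x + V.a₃)) =
          4 * (x ^ 3 + V.a₂ * x ^ 2 + V.a₄ * x + V.a₆)) with hS
  have hmem : ∀ {x y : F} {h : V.toAffine.Nonsingular x y},
      (2 : ℕ) • (Affine.Point.some x y h : V.toAffine.Point) = 0 → x ∈ S := by
    intro x y h h2P
    have hy := two_mul_y_eq_of_two_nsmul_eq_zero V h2P
    have heq : V.toAffine.Equation x y := h.1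
    rw [Affine.equation_iff] at heq
    rw [hS, Finset.mem_filter]
    refine ⟨Finset.mem_univ _, ?_⟩
    have hu : -(V.a₁ * x + V.a₃) = 2 * y := by linear_combination -hy
    rw [hu]
    linear_combination 4 * heq
  let f : {P : V.toAffine.Point // 2 • P = 0} → Option S := fun P ↦
    match P with
    | ⟨.zero, _⟩ => none
    | ⟨.some x y h, hP⟩ => some ⟨x, hmem hP⟩
  have hf : Function.Injective f := by
    rintro ⟨_ | ⟨x, y, h⟩, hP⟩ ⟨_ | ⟨x', y', h'⟩, hP'⟩ hPP'
    · rfl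
    · exact (Option.some_ne_none _ hPP'.symm).elim
    · exact (Option.some_ne_none _ hPP').elim
    · have hx : x = x' := by
        have := Option.some.inj hPP'
        exact congrArg Subtype.val this
      subst hx
      have hy : y = y' := by
        have h1 := two_mul_y_eq_of_two_nsmul_eq_zero V hP
        have h2' := two_mul_y_eq_of_two_nsmul_eq_zero V hP'
        exact mul_left_cancel₀ h2 (by linear_combination h1 - h2')
      subst hy
      rfl
  calc Nat.card {P : V.toAffine.Point // 2 • P = 0} ≤ Nat.card (Option S) := Nat.card_le_card_of_injective f hf
    _ = S.card + 1 := by rw [Nat.card_eq_fintype_card, Fintype.card_option, Fintype.card_coe]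

omit [Fintype F] in
/-- **Three roots of the `2`-division cubic (division-free reading) give `4 ≤ #E(F)[2]`**: the points `𝒪, (xᵢ, uᵢ/2)`.
[cite: SilvermanAEC2009, III.2.3] -/
theorem four_le_natCard_two_torsion [V.IsElliptic] [Finite V.toAffine.Point] (x₁ x₂ x₃ : F)
    (h12 : x₁ ≠ x₂) (h13 : x₁ ≠ x₃) (h23 : x₂ ≠ x₃)
    (hx : ∀ x ∈ [x₁, x₂, x₃],
      (-(V.a₁ * x + V.a₃)) ^ 2 + 2 * V.a₁ * x * (-(V.a₁ * x + V.a₃)) + 2 * V.a₃ * (-(V.a₁ * x + V.a₃)) =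
        4 * (x ^ 3 + V.a₂ * x ^ 2 + V.a₄ * x + V.a₆)) (h2 : (2 : F) ≠ 0) :
    4 ≤ Nat.card {P : V.toAffine.Point // 2 • P = 0} := by
  let xs : Fin 3 → F := ![x₁, x₂, x₃]
  have hxs : ∀ i, xs i ∈ [x₁, x₂, x₃] := fun i ↦ by fin_cases i <;> simp [xs]
  have hxsinj : Function.Injective xs := fun i i' h ↦ by
    fin_cases i <;> fin_cases i' <;> simp [xs] at h ⊢ <;>
      [exact h12 h; exact h13 h; exact h12 h.symm; exact h23 h; exact h13 h.symm; exact h23 h.symm]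
  have hns : ∀ i, V.toAffine.Nonsingular (xs i) (-(V.a₁ * xs i + V.a₃) / 2) := fun i ↦ by
    rw [← Affine.equation_iff_nonsingular, Affine.equation_iff]
    have h := hx (xs i) (hxs i)
    field_simp
    linear_combination h
  have hy2 : ∀ x : F, 2 * (-(V.a₁ * x + V.a₃) / 2) + V.a₁ * x + V.a₃ = 0 := fun x ↦ by
    field_simp; ring
  let f : Option (Fin 3) → {P : V.toAffine.Point // 2 • P = 0} := fun o ↦
    match o with
    | none => ⟨0, nsmul_zero _⟩
    | some i => ⟨.some (xs i) _ (hns i), two_nsmul_eq_zero_of_two_mul_y_eq V _ (hy2 (xs i))⟩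
  let g : {P : V.toAffine.Point // 2 • P = 0} → Option F := fun P ↦
    match P with
    | ⟨.zero, _⟩ => none
    | ⟨.some x _ _, _⟩ => some x
  have hgf : g ∘ f = fun o ↦ o.map xs := by
    funext o; cases o <;> rfl
  have hf : Function.Injective f := by
    apply Function.Injective.of_comp (f := g)
    rw [hgf]
    exact Option.map_injective hxsinj
  calc 4 = Nat.card (Option (Fin 3)) := by simp
    _ ≤ Nat.card {P : V.toAffine.Point // 2 • P = 0} := Nat.card_le_card_of_injective f hf

end TwoTorsion

/-! ## §3 `E(ℚ_ℓ)[2^v] ↪ Ẽ(𝔽_ℓ)` as a GROUP at a good prime `ℓ ≥ 3`, read on `integralModelInt W mod ℓ` -/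

section Local

variable (W : WeierstrassCurve ℚ) [W.IsGloballyMinimal] (ℓ : ℕ) [hℓ : Fact ℓ.Prime]

/-- **`E(ℚ_ℓ)[2^v] ↪ Ẽ(𝔽_ℓ)` as an injective GROUP homomorphism at a good prime `ℓ ≥ 3`** (`Ẽ(𝔽_ℓ)` = points of
`integralModelInt W mod ℓ` over `ZMod ℓ`): reduction `E₀(ℚ_ℓ) = E(ℚ_ℓ) → Ẽ` (tree `reductionHom`; `ℓ ∤ Δ`) is injective on
the prime-to-`ℓ` torsion `E(ℚ_ℓ)[2^v]`, then the residue-field isomorphism `𝔽_ℓ ≅ ZMod ℓ` on points.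
[cite: SilvermanAEC2009, VII.2 Prop. 2.1 and VII.3 Prop. 3.1 (PDF pp. 167–171)] -/
theorem exists_injective_addMonoidHom_twoPowTorsion_padic (h3 : 3 ≤ ℓ)
    (hΔ : ¬ (ℓ : ℤ) ∣ minimalDiscriminantInt W) (v : ℕ) :
    ∃ ρ : (DistribSMul.toAddMonoidHom (W.baseChange ℚ_[ℓ]).toAffine.Point (2 ^ v)).ker →+
        ((integralModelInt W).map (Int.castRingHom (ZMod ℓ))).toAffine.Point, Function.Injective ρ := by
  rw [← padicModel_baseChange W ℓ]
  set W₀ : WeierstrassCurve ℤ_[ℓ] := (integralModelInt W).map (Int.castRingHom ℤ_[ℓ]) with hW₀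
  have hv := integers_valuationRing_valuation ℤ_[ℓ] ℚ_[ℓ]
  have hΔ0 : IsUnit W₀.Δ := W.isUnit_Δ_padicModel ℓ hΔ
  set B := (DistribSMul.toAddMonoidHom (W₀.baseChange ℚ_[ℓ]).toAffine.Point (2 ^ v)).ker with hB
  have hBmem : ∀ P, P ∈ B ↔ (2 ^ v) • P = 0 := fun P ↦ by
    simp only [hB, AddMonoidHom.mem_ker, DistribSMul.toAddMonoidHom_apply]
  have hle : B ≤ W₀.nonsingularReductionSubgroup hv := fun P _ ↦
    hasNonsingularReduction_of_isUnit_Δ hv hΔ0 P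
  set f : B →+ (W₀.map (IsLocalRing.residue ℤ_[ℓ])).toAffine.Point :=
    (W₀.reductionHom hv).comp (AddSubgroup.inclusion hle) with hf_def
  have hℓ2 : ¬ ℓ ∣ 2 ^ v := fun h ↦ by
    have := (Nat.prime_dvd_prime_iff_eq hℓ.out Nat.prime_two).mp (hℓ.out.dvd_of_dvd_pow h)
    omega
  have hn : ValuationRing.valuation ℤ_[ℓ] ℚ_[ℓ] (((2 ^ v : ℕ) : ℤ) : ℚ_[ℓ]) = 1 :=
    X1Eleven.valuation_natCast_eq_one ℓ hℓ2
  have hf : Function.Injective f := by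
    rw [injective_iff_map_eq_zero]
    rintro ⟨Q, hQ⟩ hfQ
    have hred : W₀.reducePoint Q = 0 := hfQ
    have h0 : W₀.ReducesToZero Q := (_root_.WeierstrassCurve.reducePoint_eq_zero_iff hv (hle hQ)).mp hred
    by_contra hne
    have hkill : ((2 ^ v : ℕ) : ℤ) • Q = 0 := by rw [natCast_zsmul]; exact (hBmem Q).mp hQ
    exact not_reducesToZero_of_zsmul_eq_zero hv hn hkill (fun h ↦ hne (Subtype.ext h)) h0
  letI : Algebra (IsLocalRing.ResidueField ℤ_[ℓ]) (ZMod ℓ) :=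
    (PadicInt.residueField (p := ℓ)).toRingHom.toAlgebra
  have hV : (W₀.map (IsLocalRing.residue ℤ_[ℓ])).baseChange (ZMod ℓ) =
      (integralModelInt W).map (Int.castRingHom (ZMod ℓ)) := by
    rw [baseChange, hW₀, map_map, map_map, RingHom.algebraMap_toAlgebra]
    exact congrArg (integralModelInt W).map (RingHom.ext_int _ _)
  set g := Affine.Point.map (W' := (W₀.map (IsLocalRing.residue ℤ_[ℓ])).toAffine)
    (S := IsLocalRing.ResidueField ℤ_[ℓ])
    (Algebra.ofId (IsLocalRing.ResidueField ℤ_[ℓ]) (ZMod ℓ)) with hg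
  have hg_inj : Function.Injective g := Affine.Point.map_injective _
  set e := Affine.Point.congrEquiv hV with he
  refine ⟨(e.toAddMonoidHom.comp g).comp f, ?_⟩
  exact (e.injective.comp hg_inj).comp hf

/-- **No `ℚ_ℓ`-point of order `4` when `Ẽ(𝔽_ℓ)[2^∞] = Ẽ[2]`**: `¬ 8 ∣ #Ẽ(𝔽_ℓ)` and `4 ≤ #Ẽ(𝔽_ℓ)[2]` give
`2^v • R = 𝒪 ⇒ 2 • R = 𝒪` on `E(ℚ_ℓ)`. [cite: SilvermanAEC2009, VII.3 Prop. 3.1] -/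
theorem two_nsmul_eq_zero_padic_of_reduction (h3 : 3 ≤ ℓ) (hΔ : ¬ (ℓ : ℤ) ∣ minimalDiscriminantInt W)
    (h8 : ¬ 8 ∣ W.reductionPointCount ℓ)
    (h4 : 4 ≤ Nat.card {Q : ((integralModelInt W).map (Int.castRingHom (ZMod ℓ))).toAffine.Point // 2 • Q = 0})
    {v : ℕ} {R : (W.baseChange ℚ_[ℓ]).toAffine.Point} (hR : 2 ^ v • R = 0) : 2 • R = 0 := by
  haveI : NeZero ℓ := ⟨hℓ.out.ne_zero⟩
  haveI : Finite ((integralModelInt W).map (Int.castRingHom (ZMod ℓ))).toAffine.Point :=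
    Nat.finite_of_card_ne_zero (W.reductionPointCount_pos ℓ).ne'
  obtain ⟨ρ, hρ⟩ := exists_injective_addMonoidHom_twoPowTorsion_padic W ℓ h3 hΔ v
  have hRmem : R ∈ (DistribSMul.toAddMonoidHom (W.baseChange ℚ_[ℓ]).toAffine.Point (2 ^ v)).ker := by
    simp only [AddMonoidHom.mem_ker, DistribSMul.toAddMonoidHom_apply]; exact hR
  set x : (DistribSMul.toAddMonoidHom (W.baseChange ℚ_[ℓ]).toAffine.Point (2 ^ v)).ker := ⟨R, hRmem⟩ with hx
  have hx0 : 2 ^ v • x = 0 := Subtype.ext (by rw [AddSubgroup.coe_nsmul, AddSubgroup.coe_zero]; exact hR)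
  have h8' : ¬ 8 ∣ Nat.card ((integralModelInt W).map (Int.castRingHom (ZMod ℓ))).toAffine.Point := h8
  have h2ρ : 2 • ρ x = 0 :=
    two_nsmul_eq_zero_of_pow_nsmul_eq_zero (k := v) h8' h4 (by rw [← map_nsmul, hx0, map_zero])
  have hx2 : 2 • x = 0 := hρ (by rw [map_nsmul, h2ρ, map_zero])
  have := congrArg Subtype.val hx2
  rwa [AddSubgroup.coe_nsmul, AddSubgroup.coe_zero] at this

/-- **`#E(ℚ_ℓ)[2] ≤ #Ẽ(𝔽_ℓ)[2]`** at a good prime `ℓ ≥ 3`. [cite: SilvermanAEC2009, VII.3 Prop. 3.1] -/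
theorem natCard_two_torsion_padic_le (h3 : 3 ≤ ℓ) (hΔ : ¬ (ℓ : ℤ) ∣ minimalDiscriminantInt W) :
    Nat.card {R : (W.baseChange ℚ_[ℓ]).toAffine.Point // 2 • R = 0} ≤
      Nat.card {Q : ((integralModelInt W).map (Int.castRingHom (ZMod ℓ))).toAffine.Point // 2 • Q = 0} := by
  haveI : NeZero ℓ := ⟨hℓ.out.ne_zero⟩
  haveI : Finite ((integralModelInt W).map (Int.castRingHom (ZMod ℓ))).toAffine.Point :=
    Nat.finite_of_card_ne_zero (W.reductionPointCount_pos ℓ).ne'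
  obtain ⟨ρ, hρ⟩ := exists_injective_addMonoidHom_twoPowTorsion_padic W ℓ h3 hΔ 1
  have hmem : ∀ {R : (W.baseChange ℚ_[ℓ]).toAffine.Point}, 2 • R = 0 →
      R ∈ (DistribSMul.toAddMonoidHom (W.baseChange ℚ_[ℓ]).toAffine.Point (2 ^ 1)).ker := fun hR ↦ by
    simp only [AddMonoidHom.mem_ker, DistribSMul.toAddMonoidHom_apply, pow_one]; exact hR
  let F : {R : (W.baseChange ℚ_[ℓ]).toAffine.Point // 2 • R = 0} →
      {Q : ((integralModelInt W).map (Int.castRingHom (ZMod ℓ))).toAffine.Point // 2 • Q = 0} :=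
    fun R ↦ ⟨ρ ⟨R.1, hmem R.2⟩, by
      rw [← map_nsmul]
      have h0 : (2 • (⟨R.1, hmem R.2⟩ :
          (DistribSMul.toAddMonoidHom (W.baseChange ℚ_[ℓ]).toAffine.Point (2 ^ 1)).ker)) = 0 :=
        Subtype.ext (by rw [AddSubgroup.coe_nsmul, AddSubgroup.coe_zero]; exact R.2)
      rw [h0, map_zero]⟩
  have hF : Function.Injective F := fun R R' h ↦ by
    have h1 := hρ (congrArg Subtype.val h)
    exact Subtype.ext (congrArg Subtype.val h1)
  exact Nat.card_le_card_of_injective F hF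

end Local

/-! ## §4 The torsion-EXACT certificate `#E[2^∞]^{Gal(ℚ̄/ℚ_j)} ≤ 2` from two good primes, and the gap door -/

section Global

variable (W : WeierstrassCurve ℚ) [W.IsElliptic] [W.IsGloballyMinimal]

/-- **`#E[2^∞]^S ≤ 2` from TWO good primes** (`S ≥ Gal(ℚ̄/ℚ(μ_N))`, `N ∣ ℓᵢ − 1`, `ℓᵢ ≥ 3` good): at `ℓ₂`
(`¬ 8 ∣ #Ẽ`, `4 ≤ #Ẽ[2]`) every `S`-fixed point of `E[2^∞]` is killed by `2` (descent to `E(ℚ_{ℓ₂})`, §3); at `ℓ₁`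
(`#Ẽ[2] ≤ 2`) the fixed points inject into `E(ℚ_{ℓ₁})[2] ↪ Ẽ(𝔽_{ℓ₁})[2]`.
[cite: SilvermanAEC2009, VII.3 Prop. 3.1(b) and VIII.§1] [cite: Serre1973, Ch. II §3.1 Prop. 7] -/
theorem natCard_fixedBy_le_two_of_twoGoodPrimes (ℓ₁ ℓ₂ : ℕ) [hℓ₁ : Fact ℓ₁.Prime] [hℓ₂ : Fact ℓ₂.Prime]
    (h3₁ : 3 ≤ ℓ₁) (h3₂ : 3 ≤ ℓ₂) (hΔ₁ : ¬ (ℓ₁ : ℤ) ∣ minimalDiscriminantInt W)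
    (hΔ₂ : ¬ (ℓ₂ : ℤ) ∣ minimalDiscriminantInt W) {N : ℕ} (hN₁ : N ∣ ℓ₁ - 1) (hN₂ : N ∣ ℓ₂ - 1)
    {S : Subgroup (Field.absoluteGaloisGroup ℚ)} (hS : rootsOfUnityFixer ℚ N ≤ S)
    (h2₁ : Nat.card {Q : ((integralModelInt W).map (Int.castRingHom (ZMod ℓ₁))).toAffine.Point // 2 • Q = 0} ≤ 2)
    (h8₂ : ¬ 8 ∣ W.reductionPointCount ℓ₂)
    (h4₂ : 4 ≤ Nat.card {Q : ((integralModelInt W).map (Int.castRingHom (ZMod ℓ₂))).toAffine.Point // 2 • Q = 0}) :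
    Nat.card {m : geomPrimaryTorsion W 2 | ∀ σ ∈ S, σ • m = m} ≤ 2 := by
  have hgood₁ : W.HasGoodReductionAtPrime ℓ₁ := hasGoodReductionAtPrime_of_not_dvd W ℓ₁ hΔ₁
  have hgood₂ : W.HasGoodReductionAtPrime ℓ₂ := hasGoodReductionAtPrime_of_not_dvd W ℓ₂ hΔ₂
  have hkill : ∀ m : {m : geomPrimaryTorsion W 2 | ∀ σ ∈ S, σ • m = m},
      (2 : ℕ) • ((m : geomPrimaryTorsion W 2) : geomPoints W) = 0 := by
    intro m
    obtain ⟨R, hR, hRm⟩ :=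
      TowerClass.exists_point_padic_of_fixedBy W 2 ℓ₂ h3₂ hgood₂ hN₂ hS (m : geomPrimaryTorsion W 2) m.2
    have h2R : 2 • R = 0 := two_nsmul_eq_zero_padic_of_reduction W ℓ₂ h3₂ hΔ₂ h8₂ h4₂ hR
    apply pointsMapOfEmb_injective W (closureEmb (K := ℚ) ℚ_[ℓ₂])
    rw [map_nsmul, ← hRm, ← map_nsmul, ← map_nsmul, h2R, map_zero, map_zero, map_zero]
  have hdesc := fun m : {m : geomPrimaryTorsion W 2 | ∀ σ ∈ S, σ • m = m} ↦
    TowerClass.exists_point_padic_of_fixedBy W 2 ℓ₁ h3₁ hgood₁ hN₁ hS (m : geomPrimaryTorsion W 2) m.2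
  have h2desc : ∀ m : {m : geomPrimaryTorsion W 2 | ∀ σ ∈ S, σ • m = m}, 2 • (hdesc m).choose = 0 := by
    intro m
    have hRm := (hdesc m).choose_spec.2
    apply toGeomPoints_injective (W.baseChange ℚ_[ℓ₁])
    apply (W.baseChangeGeomPointsEquiv ℚ_[ℓ₁]).injective
    rw [map_nsmul, map_nsmul, hRm, ← map_nsmul, hkill m, map_zero, map_zero, map_zero]
  let f : {m : geomPrimaryTorsion W 2 | ∀ σ ∈ S, σ • m = m} →
      {R : (W.baseChange ℚ_[ℓ₁]).toAffine.Point // 2 • R = 0} := fun m ↦ ⟨(hdesc m).choose, h2desc m⟩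
  have hf : Function.Injective f := fun m m' hmm' ↦ by
    have h1 := (hdesc m).choose_spec.2
    have h2 := (hdesc m').choose_spec.2
    have heq : (hdesc m).choose = (hdesc m').choose := congrArg Subtype.val hmm'
    rw [heq, h2] at h1
    exact Subtype.ext (Subtype.ext (pointsMapOfEmb_injective W _ h1.symm))
  haveI : NeZero ℓ₁ := ⟨hℓ₁.out.ne_zero⟩
  haveI : Finite ((integralModelInt W).map (Int.castRingHom (ZMod ℓ₁))).toAffine.Point :=
    Nat.finite_of_card_ne_zero (W.reductionPointCount_pos ℓ₁).ne'
  haveI : Finite {R : (W.baseChange ℚ_[ℓ₁]).toAffine.Point // 2 • R = 0} := by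
    obtain ⟨ρ, hρ⟩ := exists_injective_addMonoidHom_twoPowTorsion_padic W ℓ₁ h3₁ hΔ₁ 1
    have hmem : ∀ {R : (W.baseChange ℚ_[ℓ₁]).toAffine.Point}, 2 • R = 0 →
        R ∈ (DistribSMul.toAddMonoidHom (W.baseChange ℚ_[ℓ₁]).toAffine.Point (2 ^ 1)).ker := fun hR ↦ by
      simp only [AddMonoidHom.mem_ker, DistribSMul.toAddMonoidHom_apply, pow_one]; exact hR
    exact Finite.of_injective (fun R : {R : (W.baseChange ℚ_[ℓ₁]).toAffine.Point // 2 • R = 0} ↦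
      ρ ⟨R.1, hmem R.2⟩) fun R R' h ↦ Subtype.ext (congrArg Subtype.val (hρ h))
  calc Nat.card {m : geomPrimaryTorsion W 2 | ∀ σ ∈ S, σ • m = m}
      ≤ Nat.card {R : (W.baseChange ℚ_[ℓ₁]).toAffine.Point // 2 • R = 0} := Nat.card_le_card_of_injective f hf
    _ ≤ Nat.card {Q : ((integralModelInt W).map (Int.castRingHom (ZMod ℓ₁))).toAffine.Point // 2 • Q = 0} :=
        natCard_two_torsion_padic_le W ℓ₁ h3₁ hΔ₁
    _ ≤ 2 := h2₁

end Global

end Summit.BirchSwinnertonDyer.BirchSwinnertonDyer.Theorems.TowerLayer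

/-! ## §5 The torsion-tolerant gap door at a pair `(j, j')` with the torsion-EXACT certificate (`t = 1`) -/

namespace Summit.BirchSwinnertonDyer.BirchSwinnertonDyer.Theorems.TowerClass

open Summit.BirchSwinnertonDyer.Rank1Residual.X5.O1 Summit.BirchSwinnertonDyer.BirchSwinnertonDyer.Theorems

variable (W : WeierstrassCurve ℚ) [W.IsElliptic] [W.IsGloballyMinimal]

/-- **Gap from `(j, j')` class counts with torsion `t = 1` CERTIFIED by two good primes `ℓ₁, ℓ₂ ≡ 1 (mod 2^{j+2})`**
(`ℓ₁`: `#Ẽ[2] ≤ 2`; `ℓ₂`: `¬ 8 ∣ #Ẽ`, `4 ≤ #Ẽ[2]`): PRINT `hB` + CERT {`2^a ≤ #A_j[2]`, `#A_{j'}[2] ≤ 2^d`, the two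
primes, `d + 2 ≤ 2^{j'} − 2^j + a`} ⇒ `O1.TowerGapAtTwo W` (`towerGapAtTwo_of_classCounts_of_torsion` with `htor` discharged).
[cite: GreenbergLNM1716, §1 p. 60 and p. 62, §3 pp. 85–86, §4 Lemma 4.3] [cite: SilvermanAEC2009, VII.3 Prop. 3.1(b)] -/
theorem towerGapAtTwo_of_classCounts_of_twoGoodPrimes_layer
    (hB : Greenberg1999.finite_torsion_cyclotomicZpExtension) {j j' a d : ℕ} (hjj' : j ≤ j')
    (ℓ₁ ℓ₂ : ℕ) [Fact ℓ₁.Prime] [Fact ℓ₂.Prime] (h3₁ : 3 ≤ ℓ₁) (h3₂ : 3 ≤ ℓ₂)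
    (hΔ₁ : ¬ (ℓ₁ : ℤ) ∣ minimalDiscriminantInt W) (hΔ₂ : ¬ (ℓ₂ : ℤ) ∣ minimalDiscriminantInt W)
    (hℓ₁ : 2 ^ (j + 2) ∣ ℓ₁ - 1) (hℓ₂ : 2 ^ (j + 2) ∣ ℓ₂ - 1)
    (h2₁ : Nat.card {Q : ((integralModelInt W).map (Int.castRingHom (ZMod ℓ₁))).toAffine.Point // 2 • Q = 0} ≤ 2)
    (h8₂ : ¬ 8 ∣ W.reductionPointCount ℓ₂)
    (h4₂ : 4 ≤ Nat.card {Q : ((integralModelInt W).map (Int.castRingHom (ZMod ℓ₂))).toAffine.Point // 2 • Q = 0})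
    (hlow : ∀ κ : ZpExtension ℚ 2, κ.IsCyclotomic →
      2 ^ a ≤ Nat.card {z : W.selmerInftyPreimage κ j // 2 • z = 0})
    (hup : ∀ κ : ZpExtension ℚ 2, κ.IsCyclotomic →
      Nat.card {z : W.selmerInftyPreimage κ j' // 2 • z = 0} ≤ 2 ^ d)
    (had : d + 1 + 1 ≤ 2 ^ j' - 2 ^ j + a) : TowerGapAtTwo W :=
  towerGapAtTwo_of_classCounts_of_torsion W (fun κ hκ ↦ hB W 2 κ hκ) hjj' hlow
    (fun _ hκ ↦ (pow_one 2).symm ▸ TowerLayer.natCard_fixedBy_le_two_of_twoGoodPrimes W ℓ₁ ℓ₂ h3₁ h3₂ hΔ₁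
      hΔ₂ hℓ₁ hℓ₂ (hκ.rootsOfUnityFixer_le_layerSubgroup_two j) h2₁ h8₂ h4₂) hup (t := 1) had

end Summit.BirchSwinnertonDyer.BirchSwinnertonDyer.Theorems.TowerClass

end
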